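import Literature.Analysis.SegalBargmann.SchwartzTorusIdentification
import Literature.MathematicalPhysics.QuantumLattice.SchwartzTensor
import HarnessLib

/-!
# Schwartz functions in separate variables on `ℝ^{σ₁} × ℝ^{σ₂} = ℝ^{σ₁ ⊕ σ₂}` and the factorisation of the Hermite functions (Folland 1989, §1.7)

Topic `Analysis/SegalBargmann`; namespace `Literature.Analysis.SegalBargmann`.  On the Folland carriers
`𝓢(σ → ℝ, ℂ)` of this topic, the product in separate variables

  `tensorPi f g : 𝓢(σ₁ ⊕ σ₂ → ℝ, ℂ)`,  `(f ⊠ g)(x) = f (x ∘ inl) · g (x ∘ inr)`,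

built on the TREE constructor `SchwartzMap.mulComp` (`Literature/MathematicalPhysics/QuantumLattice/SchwartzTensor`, the
product of two Schwartz functions pulled back along maps that jointly control the norm — reused, not re-proved), with:

* §1 `tensorPi`, pointwise formula, bilinearity (`tensorPiₗ`);
* §2 SYMBOL ALGEBRA on `MvPolynomial (σ₁ ⊕ σ₂) ℂ`: the Bargmann symbol map `binv` (`FockHermite`) is multiplicative
  across the two groups of variables — `binv (rename inl F₁ * rename inr F₂) = rename inl (binv F₁) * rename inr (binv F₂)`
  (induction on monomials with `binv_X_mul` and `opZs_apply`; the vacuum constants multiply,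
  `vacCoef (σ₁ ⊕ σ₂) = vacCoef σ₁ · vacCoef σ₂`), and Folland's symbols factor:
  `herm (sumIdx α₁ α₂) = rename inl (herm α₁) * rename inr (herm α₂)` (`hcoef` is multiplicative);
* §3 **the Hermite functions factor**: `hermitePi (sumIdx α₁ α₂) = tensorPi (hermitePi α₁) (hermitePi α₂)`
  (`hermitePi_sumIdx`), every multi-index on `σ₁ ⊕ σ₂` being a `sumIdx` (`sumIdx_comapDomain`).

This is the vocabulary for the two-factor statements of the pub-hodgecm node W2-⊗ (restriction of the big oscillator
representation to a see-saw sub-pair); everything is proved from Mathlib and the imported tree files, no cited statement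
is used as a hypothesis.

## References

* [Folland1989] G. B. Folland, *Harmonic Analysis in Phase Space*, Princeton UP (1989), §1.7 (Hermite functions on
  `ℝⁿ` are products of one-variable Hermite functions, (1.81)). [cite: Folland1989, §1.7]

## Provenance

LEAN-IN-TREE rule (2026-08-18), pub-hodgecm model-construction sub-cell, seat mc-binder-2 gen 2 (node W2-⊗, piece (⊗S) P1).
-/

set_option autoImplicit false

noncomputable section

open MeasureTheory Complex SchwartzMap Filter Topology MvPolynomial
open scoped InnerProductSpace ComplexConjugate Real BigOperators

namespace Literature.Analysis.SegalBargmann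

variable {σ₁ σ₂ : Type*} [Fintype σ₁] [Fintype σ₂]

local notation "SR" σ => SchwartzMap (σ → ℝ) ℂ

/-! ## §1  The product in separate variables -/

section Tensor

omit [Fintype σ₁] [Fintype σ₂] in
/-- The sup norm of `x : σ₁ ⊕ σ₂ → ℝ` is controlled by the norms of its two restrictions. [folklore] -/
theorem norm_le_max_norm_restrict [Fintype σ₁] [Fintype σ₂] (x : σ₁ ⊕ σ₂ → ℝ) :
    ‖x‖ ≤ 1 * max ‖SchwartzMap.restrictCLM (E := ℝ) Sum.inl x‖ ‖SchwartzMap.restrictCLM (E := ℝ) Sum.inr x‖ := by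
  rw [one_mul, pi_norm_le_iff_of_nonneg (by positivity)]
  rintro (i | i)
  · exact (norm_le_pi_norm (x ∘ Sum.inl) i).trans (le_max_left _ _)
  · exact (norm_le_pi_norm (x ∘ Sum.inr) i).trans (le_max_right _ _)

/-- **The product of Schwartz functions in separate variables** `(f ⊠ g)(x) = f (x ∘ inl) · g (x ∘ inr)` on
`σ₁ ⊕ σ₂ → ℝ` (the tree's `SchwartzMap.mulComp` along the two restrictions). [cite: Folland1989, §1.7] -/
def tensorPi (f : SR σ₁) (g : SR σ₂) : SR (σ₁ ⊕ σ₂) :=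
  SchwartzMap.mulComp f g (SchwartzMap.restrictCLM (E := ℝ) Sum.inl) (SchwartzMap.restrictCLM (E := ℝ) Sum.inr)
    ⟨1, norm_le_max_norm_restrict⟩

/-- Pointwise: `tensorPi f g x = f (x ∘ inl) * g (x ∘ inr)`. [folklore] -/
@[simp] theorem tensorPi_apply (f : SR σ₁) (g : SR σ₂) (x : σ₁ ⊕ σ₂ → ℝ) :
    tensorPi f g x = f (x ∘ Sum.inl) * g (x ∘ Sum.inr) := rfl

/-- Additivity in the first factor. [folklore] -/
theorem tensorPi_add_left (f f' : SR σ₁) (g : SR σ₂) : tensorPi (f + f') g = tensorPi f g + tensorPi f' g := by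
  ext x; simp [add_mul]

/-- Additivity in the second factor. [folklore] -/
theorem tensorPi_add_right (f : SR σ₁) (g g' : SR σ₂) : tensorPi f (g + g') = tensorPi f g + tensorPi f g' := by
  ext x; simp [mul_add]

/-- Homogeneity in the first factor. [folklore] -/
theorem tensorPi_smul_left (c : ℂ) (f : SR σ₁) (g : SR σ₂) : tensorPi (c • f) g = c • tensorPi f g := by
  ext x; simp [mul_assoc]

/-- Homogeneity in the second factor. [folklore] -/
theorem tensorPi_smul_right (c : ℂ) (f : SR σ₁) (g : SR σ₂) : tensorPi f (c • g) = c • tensorPi f g := by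
  ext x; simp [mul_left_comm]

/-- `f ⊠ 0 = 0`, `0 ⊠ g = 0`. [folklore] -/
@[simp] theorem tensorPi_zero_left (g : SR σ₂) : tensorPi (0 : SR σ₁) g = 0 := by ext x; simp
/-- see `tensorPi_zero_left`. [folklore] -/
@[simp] theorem tensorPi_zero_right (f : SR σ₁) : tensorPi f (0 : SR σ₂) = 0 := by ext x; simp

/-- **`⊠` as a bilinear map** `𝓢(ℝ^{σ₁}) →ₗ 𝓢(ℝ^{σ₂}) →ₗ 𝓢(ℝ^{σ₁ ⊕ σ₂})`. [folklore] -/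
def tensorPiₗ : (SR σ₁) →ₗ[ℂ] (SR σ₂) →ₗ[ℂ] SR (σ₁ ⊕ σ₂) :=
  LinearMap.mk₂ ℂ tensorPi tensorPi_add_left tensorPi_smul_left tensorPi_add_right tensorPi_smul_right

/-- Unfolding. [folklore] -/
@[simp] theorem tensorPiₗ_apply (f : SR σ₁) (g : SR σ₂) : tensorPiₗ f g = tensorPi f g := rfl

end Tensor

/-! ## §2  Symbol algebra across the two groups of variables -/

section Symbols

variable [DecidableEq σ₁] [DecidableEq σ₂]

/-- The combined multi-index of `(α₁, α₂)`: `sumIdx α₁ α₂ = α₁ ∘ inl⁻¹ + α₂ ∘ inr⁻¹` on `σ₁ ⊕ σ₂`. [folklore] -/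
def sumIdx (α₁ : σ₁ →₀ ℕ) (α₂ : σ₂ →₀ ℕ) : σ₁ ⊕ σ₂ →₀ ℕ :=
  α₁.mapDomain Sum.inl + α₂.mapDomain Sum.inr

omit [Fintype σ₁] [Fintype σ₂] [DecidableEq σ₁] [DecidableEq σ₂] in
/-- `sumIdx α₁ α₂ (inl i) = α₁ i`. [folklore] -/
@[simp] theorem sumIdx_inl (α₁ : σ₁ →₀ ℕ) (α₂ : σ₂ →₀ ℕ) (i : σ₁) : sumIdx α₁ α₂ (Sum.inl i) = α₁ i := by
  rw [sumIdx, Finsupp.add_apply, Finsupp.mapDomain_apply Sum.inl_injective,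
    Finsupp.mapDomain_notin_range _ _ (by simp), add_zero]

omit [Fintype σ₁] [Fintype σ₂] [DecidableEq σ₁] [DecidableEq σ₂] in
/-- `sumIdx α₁ α₂ (inr i) = α₂ i`. [folklore] -/
@[simp] theorem sumIdx_inr (α₁ : σ₁ →₀ ℕ) (α₂ : σ₂ →₀ ℕ) (i : σ₂) : sumIdx α₁ α₂ (Sum.inr i) = α₂ i := by
  rw [sumIdx, Finsupp.add_apply, Finsupp.mapDomain_notin_range _ _ (by simp),
    Finsupp.mapDomain_apply Sum.inr_injective, zero_add]

omit [Fintype σ₁] [Fintype σ₂] [DecidableEq σ₁] [DecidableEq σ₂] in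
/-- Every multi-index on `σ₁ ⊕ σ₂` is a `sumIdx` of its two restrictions. [folklore] -/
theorem sumIdx_comapDomain (α : σ₁ ⊕ σ₂ →₀ ℕ) :
    sumIdx (α.comapDomain Sum.inl Sum.inl_injective.injOn) (α.comapDomain Sum.inr Sum.inr_injective.injOn) = α := by
  ext (i | i) <;> simp [Finsupp.comapDomain_apply]

omit [Fintype σ₁] [Fintype σ₂] [DecidableEq σ₁] [DecidableEq σ₂] in
/-- The monomial of a combined index is the product of the renamed monomials. [folklore] -/
theorem monomial_sumIdx (α₁ : σ₁ →₀ ℕ) (α₂ : σ₂ →₀ ℕ) :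
    (monomial (sumIdx α₁ α₂) (1 : ℂ)) =
      rename Sum.inl (monomial α₁ (1 : ℂ)) * rename Sum.inr (monomial α₂ (1 : ℂ)) := by
  rw [rename_monomial, rename_monomial, monomial_mul, one_mul, sumIdx]

omit [Fintype σ₁] [Fintype σ₂] in
/-- A polynomial in the `inr`-variables has no `inl`-partial derivatives. [folklore] -/
theorem pderiv_inl_rename_inr (i : σ₁) (G : MvPolynomial σ₂ ℂ) :
    pderiv (Sum.inl i) (rename (Sum.inr : σ₂ → σ₁ ⊕ σ₂) G) = 0 := by
  induction G using MvPolynomial.induction_on with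
  | C a => simp
  | add p q hp hq => simp [hp, hq]
  | mul_X p k hp => simp [hp, pderiv_X]

omit [Fintype σ₁] [Fintype σ₂] in
/-- A polynomial in the `inl`-variables has no `inr`-partial derivatives. [folklore] -/
theorem pderiv_inr_rename_inl (i : σ₂) (F : MvPolynomial σ₁ ℂ) :
    pderiv (Sum.inr i) (rename (Sum.inl : σ₁ → σ₁ ⊕ σ₂) F) = 0 := by
  induction F using MvPolynomial.induction_on with
  | C a => simp
  | add p q hp hq => simp [hp, hq]
  | mul_X p k hp => simp [hp, pderiv_X]

omit [Fintype σ₁] [Fintype σ₂] in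
/-- `Z_{inl i}^*` acts on a product `rename inl F * rename inr G` through the first factor. [folklore] -/
theorem opZs_inl_mul (i : σ₁) (F : MvPolynomial σ₁ ℂ) (G : MvPolynomial σ₂ ℂ) :
    opZs (Sum.inl i) (rename Sum.inl F * rename Sum.inr G) =
      rename Sum.inl (opZs i F) * rename Sum.inr G := by
  rw [opZs_apply, opZs_apply, Derivation.leibniz, pderiv_inl_rename_inr, smul_zero, zero_add,
    pderiv_rename Sum.inl_injective, smul_eq_mul]
  simp only [MvPolynomial.smul_eq_C_mul, map_sub, map_mul, rename_C, rename_X]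
  ring

omit [Fintype σ₁] [Fintype σ₂] in
/-- `Z_{inr i}^*` acts on a product `rename inl F * rename inr G` through the second factor. [folklore] -/
theorem opZs_inr_mul (i : σ₂) (F : MvPolynomial σ₁ ℂ) (G : MvPolynomial σ₂ ℂ) :
    opZs (Sum.inr i) (rename Sum.inl F * rename Sum.inr G) =
      rename Sum.inl F * rename Sum.inr (opZs i G) := by
  rw [opZs_apply, opZs_apply, Derivation.leibniz, pderiv_inr_rename_inl, smul_zero, add_zero,
    pderiv_rename Sum.inr_injective, smul_eq_mul]
  simp only [MvPolynomial.smul_eq_C_mul, map_sub, map_mul, rename_C, rename_X]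
  ring

omit [DecidableEq σ₁] [DecidableEq σ₂] in
/-- **The vacuum constants multiply**: `2^{(n₁+n₂)/4} = 2^{n₁/4} 2^{n₂/4}`. [folklore] -/
theorem vacCoef_sum : vacCoef (σ₁ ⊕ σ₂) = vacCoef σ₁ * vacCoef σ₂ := by
  rw [vacCoef, vacCoef, vacCoef, Fintype.card_sum, Nat.cast_add, add_div, Real.rpow_add two_pos]

omit [DecidableEq σ₁] [DecidableEq σ₂] in
/-- `vac (σ₁ ⊕ σ₂) = rename inl (vac σ₁) * rename inr (vac σ₂)`. [folklore] -/
theorem vac_sum : vac (σ₁ ⊕ σ₂) = rename Sum.inl (vac σ₁) * rename Sum.inr (vac σ₂) := by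
  rw [vac, vac, vac, rename_C, rename_C, ← C_mul, vacCoef_sum, Complex.ofReal_mul]

/-- `binv` through the second group of variables with the first factor constant:
`binv (rename inl (vac σ₁)-free…)` — auxiliary: `binv (C a * rename inr G) = a • rename inl (vac σ₁) * rename inr (binv G)`.
[folklore] -/
theorem binv_C_mul_rename_inr (a : ℂ) (G : MvPolynomial σ₂ ℂ) :
    binv (C a * rename (Sum.inr : σ₂ → σ₁ ⊕ σ₂) G) =
      a • (rename Sum.inl (vac σ₁) * rename Sum.inr (binv G)) := by
  induction G using MvPolynomial.induction_on with
  | C b =>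
      rw [rename_C, ← C_mul, binv_C, binv_C, map_smul, vac_sum, mul_smul_comm, mul_smul]
  | add p q hp hq =>
      rw [map_add, mul_add, map_add, hp, hq, map_add, map_add, mul_add, smul_add]
  | mul_X p k hp =>
      rw [map_mul (rename _), rename_X,
        show C a * (rename Sum.inr p * X (Sum.inr k)) = X (Sum.inr k) * (C a * rename (Sum.inr : σ₂ → σ₁ ⊕ σ₂) p) by
          ring,
        binv_X_mul, hp, map_smul, opZs_inr_mul, mul_comm p (X k), binv_X_mul]

/-- **`binv` is multiplicative across the two groups of variables**:
`binv (rename inl F * rename inr G) = rename inl (binv F) * rename inr (binv G)`. [cite: Folland1989, §1.7] -/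
theorem binv_rename_mul (F : MvPolynomial σ₁ ℂ) (G : MvPolynomial σ₂ ℂ) :
    binv (rename (Sum.inl : σ₁ → σ₁ ⊕ σ₂) F * rename Sum.inr G) =
      rename Sum.inl (binv F) * rename Sum.inr (binv G) := by
  induction F using MvPolynomial.induction_on with
  | C a =>
      rw [rename_C, binv_C_mul_rename_inr, binv_C, map_smul, smul_mul_assoc]
  | add p q hp hq =>
      rw [map_add, add_mul, map_add, hp, hq, map_add, map_add, add_mul]
  | mul_X p k hp =>
      rw [map_mul (rename _), rename_X,
        show rename (Sum.inl : σ₁ → σ₁ ⊕ σ₂) p * X (Sum.inl k) * rename Sum.inr G =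
            X (Sum.inl k) * (rename Sum.inl p * rename Sum.inr G) by ring,
        binv_X_mul, hp, opZs_inl_mul, mul_comm p (X k), binv_X_mul]

omit [DecidableEq σ₁] [DecidableEq σ₂] in
/-- `mdeg` is additive over `sumIdx`. [folklore] -/
theorem mdeg_sumIdx (α₁ : σ₁ →₀ ℕ) (α₂ : σ₂ →₀ ℕ) : mdeg (sumIdx α₁ α₂) = mdeg α₁ + mdeg α₂ := by
  simp [mdeg, Fintype.sum_sum_type]

omit [DecidableEq σ₁] [DecidableEq σ₂] in
/-- `mfact` is multiplicative over `sumIdx`. [folklore] -/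
theorem mfact_sumIdx (α₁ : σ₁ →₀ ℕ) (α₂ : σ₂ →₀ ℕ) : mfact (sumIdx α₁ α₂) = mfact α₁ * mfact α₂ := by
  simp [mfact, Fintype.prod_sum_type]

omit [DecidableEq σ₁] [DecidableEq σ₂] in
/-- `hcoef` is multiplicative over `sumIdx`. [folklore] -/
theorem hcoef_sumIdx (α₁ : σ₁ →₀ ℕ) (α₂ : σ₂ →₀ ℕ) : hcoef (sumIdx α₁ α₂) = hcoef α₁ * hcoef α₂ := by
  rw [hcoef, hcoef, hcoef, mdeg_sumIdx, mfact_sumIdx, pow_add, Nat.cast_mul, mul_div_mul_comm,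
    Real.sqrt_mul (by positivity)]

/-- **Folland's Hermite symbols factor**: `herm (sumIdx α₁ α₂) = rename inl (herm α₁) * rename inr (herm α₂)`.
[cite: Folland1989, §1.7] -/
theorem herm_sumIdx (α₁ : σ₁ →₀ ℕ) (α₂ : σ₂ →₀ ℕ) :
    herm (sumIdx α₁ α₂) = rename Sum.inl (herm α₁) * rename Sum.inr (herm α₂) := by
  rw [herm_eq, herm_eq, herm_eq, monomial_sumIdx, binv_rename_mul, hcoef_sumIdx, Complex.ofReal_mul, map_smul,
    map_smul, smul_mul_smul_comm, mul_smul]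

end Symbols

/-! ## §3  The Hermite functions factor -/

section Hermite

variable [DecidableEq σ₁] [DecidableEq σ₂]

omit [DecidableEq σ₁] [DecidableEq σ₂] in
/-- The Gaussian factors: `e^{−π|x|²} = e^{−π|x∘inl|²} e^{−π|x∘inr|²}`. [folklore] -/
theorem gauss_sum (x : σ₁ ⊕ σ₂ → ℝ) : gauss x = gauss (x ∘ Sum.inl) * gauss (x ∘ Sum.inr) := by
  rw [gauss, gauss, gauss, ← Complex.exp_add, Fintype.sum_sum_type]
  congr 1
  simp only [Function.comp_apply]
  ring

omit [DecidableEq σ₁] [DecidableEq σ₂] in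
/-- `hermiteFun` of a product of renamed symbols is the product of the `hermiteFun`s. [folklore] -/
theorem hermiteFun_rename_mul (F : MvPolynomial σ₁ ℂ) (G : MvPolynomial σ₂ ℂ) (x : σ₁ ⊕ σ₂ → ℝ) :
    hermiteFun (rename Sum.inl F * rename Sum.inr G) x = hermiteFun F (x ∘ Sum.inl) * hermiteFun G (x ∘ Sum.inr) := by
  rw [hermiteFun, hermiteFun, hermiteFun, map_mul, eval_rename, eval_rename, gauss_sum]
  have h1 : ((fun k : σ₁ ⊕ σ₂ => ((x k : ℝ) : ℂ)) ∘ Sum.inl) = fun k => (((x ∘ Sum.inl) k : ℝ) : ℂ) := rfl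
  have h2 : ((fun k : σ₁ ⊕ σ₂ => ((x k : ℝ) : ℂ)) ∘ Sum.inr) = fun k => (((x ∘ Sum.inr) k : ℝ) : ℂ) := rfl
  rw [h1, h2]
  ring

/-- **The Hermite functions on `ℝ^{σ₁ ⊕ σ₂}` are products**: `h_{(α₁,α₂)} = h_{α₁} ⊠ h_{α₂}`, i.e.
`hermitePi (sumIdx α₁ α₂) = tensorPi (hermitePi α₁) (hermitePi α₂)`. [cite: Folland1989, §1.7] -/
theorem hermitePi_sumIdx (α₁ : σ₁ →₀ ℕ) (α₂ : σ₂ →₀ ℕ) :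
    (hermitePi (sumIdx α₁ α₂) : SR (σ₁ ⊕ σ₂)) = tensorPi (hermitePi α₁) (hermitePi α₂) := by
  ext x
  rw [hermitePi_apply, tensorPi_apply, hermitePi_apply, hermitePi_apply, herm_sumIdx, hermiteFun_rename_mul]

/-- Every Hermite function on `ℝ^{σ₁ ⊕ σ₂}` is a product of Hermite functions of the two groups of variables.
[cite: Folland1989, §1.7] -/
theorem hermitePi_eq_tensorPi (α : σ₁ ⊕ σ₂ →₀ ℕ) :
    (hermitePi α : SR (σ₁ ⊕ σ₂)) =
      tensorPi (hermitePi (α.comapDomain Sum.inl Sum.inl_injective.injOn))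
        (hermitePi (α.comapDomain Sum.inr Sum.inr_injective.injOn)) := by
  rw [← hermitePi_sumIdx, sumIdx_comapDomain]

end Hermite

end Literature.Analysis.SegalBargmann
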